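import Literature.Geometry.Riemannian.RicciFlow
import HarnessLib

/-!
# Scaling of metrics and of Ricci flows: homotheties, parabolic rescaling, Einstein solutions
(topic `Geometry/Riemannian`)

Companion of `RicciFlow.lean` (definitions `Literature.Geometry.Riemannian.IsContMDiffFamilyOn`,
`Literature.Geometry.Riemannian.IsRicciFlow`). Everything in this file is PROVED; it supplies the elementary
symmetries of Hamilton's Ricci flow `∂g/∂t = -2 Ric(g)` that the sources use without comment,
over the tree's `Literature.Geometry.Lorentzian.PseudoRiemannianMetric` / `CovariantDerivative.ricci`:

* `PseudoRiemannianMetric.constSmul g c hc` — the constant multiple `c • g` of a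
  pseudo-Riemannian metric on a vector bundle (`c ≠ 0`; Riemannian for `c > 0` if `g` is), with
  `IsCompatible.constSmul`, `IsLeviCivita.constSmul` / `isLeviCivita_constSmul_iff`: **the
  Levi-Civita connection is invariant under homothety** (Topping 2006, §1.2.3: under `g ↦ λ g`
  "the connection also remains invariant"), `curvatureForm_constSmul` (`Rm_{c g} = c Rm_g` for a
  fixed connection) and `hasPositiveIsotropicCurvature_constSmul_iff`: **positive isotropic
  curvature is invariant under homothety** (`c > 0`).
* `contMDiffWithinAt_totalSpace_smul` — scalar multiples `p ↦ (b p, f p • v p)` of `C^k` maps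
  into the total space of a vector bundle are `C^k` (the base-map generalisation of Mathlib's
  `ContMDiffWithinAt.smul_section`), whence `IsContMDiffFamilyOn.constSmul`, `.smul`,
  `.comp_affine` for one-parameter families of metrics.
* `IsRicciFlow.parabolicRescale` — **parabolic rescaling** (Topping 2006, §1.2.3, (1.2.7)): if
  `(g, cov)` is a Ricci flow on the time set `S` then `t ↦ λ g(t/λ)`, with the connections
  `t ↦ cov (t/λ)`, is a Ricci flow on `λ S` for every `λ > 0`; Riemannian-ness and PIC go along
  (`isRiemannian_parabolicRescale`, `hasPositiveIsotropicCurvature_parabolicRescale`). This is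
  the rescaling used to blow up singularities (Hamilton 1997, §E; Chen–Zhu 2006, §§3–4).
* `isRicciFlow_einsteinFamily` — **Einstein metrics evolve homothetically** (Topping 2006,
  §1.2.1): if `cov₀` is a Levi-Civita connection of `g₀` with `Ric = λ g₀`, then
  `t ↦ (1 - 2λt) g₀` (`einsteinFamily g₀ λ`, constant connection `cov₀`) is a Ricci flow on every
  time set where `1 - 2λt > 0`, in particular on `[0, 1/(2λ))` for `λ > 0` (shrinkers, e.g. the
  round sphere, `λ = n - 1`, extinct at `T = 1/(2(n-1))`) and for all times when `λ = 0`
  (Ricci-flat metrics are static, `isRicciFlow_einsteinFamily_zero`).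

## Design notes

* `constSmul` takes the proof `hc : c ≠ 0` as an argument (nondegeneracy must be preserved); the
  homothetic family of an Einstein metric is made total in `t` through the non-vanishing
  modification `einsteinFactor λ t` of `1 - 2λt` (value `1` where `1 - 2λt ≤ 0`); all statements
  concern time sets on which `1 - 2λt > 0`, where `einsteinFamily g₀ λ t = (1 - 2λt) • g₀`
  (`einsteinFamily_apply`).
* The Ricci tensor `CovariantDerivative.ricci cov` depends on the connection only, so its
  invariance under `g ↦ c g` is literally `rfl` once `IsLeviCivita.constSmul` identifies the
  connections; the hypothesis "`Ric(g₀) = λ g₀`" is phrased on an explicit Levi-Civita witness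
  `cov₀` (`∀ x X Y, cov₀.ricci x X Y = λ * g₀.val x X Y`), as in `RicciFlow.lean`.
* `mvfderiv_const_mul` (`d(c f) = c df` with Mathlib's junk-value conventions, no
  differentiability hypothesis) is the one-line calculus fact behind `IsCompatible.constSmul`.
* `constSmul` and the lemmas of the first part are deliberate dot-notation extensions of the
  namespace `Literature.Geometry.Lorentzian.PseudoRiemannianMetric` of the Lorentzian topic (the structure lives in
  `Literature/Geometry/Lorentzian/PseudoRiemannianMetric.lean`); they are stated in the full
  vector-bundle generality of that structure and kept in this file so as not to touch (and
  rebuild) the Lorentzian topic.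

## References

* P. Topping, *Lectures on the Ricci flow*, LMS Lecture Note Series 325, Cambridge Univ. Press
  2006: §1.2.1 (Einstein manifolds: `g(t) = (1 - 2λt) g₀`; round sphere extinct at
  `T = 1/(2(n-1))`), §1.2.3 (parabolic rescaling (1.2.7), invariance of the connection and of
  `Ric`). [Topping2006]
* R. S. Hamilton, *Four-manifolds with positive isotropic curvature*, Comm. Anal. Geom. 5 (1997)
  1–92, §1 (PIC), §E (blow-up by rescaling). [Hamilton1997]
* B.-L. Chen, X.-P. Zhu, *Ricci flow with surgery on four-manifolds with positive isotropic
  curvature*, J. Differential Geom. 74 (2006) 177–264, §§3–4 (rescaling arguments). [ChenZhu2006]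
* B. O'Neill, *Semi-Riemannian geometry*, Academic Press 1983, Ch. 3 (Def. 3.1, Thm. 3.11).
  [ONeill1983]
-/

noncomputable section

open Bundle Set Filter
open scoped Manifold ContDiff Topology

namespace Literature.Geometry.Riemannian

section PseudoRiemannianMetric
open Literature.Geometry.Lorentzian (PseudoRiemannianMetric)
open Literature.Geometry.Lorentzian.PseudoRiemannianMetric

section Bundle

variable
  {EB : Type*} [NormedAddCommGroup EB] [NormedSpace ℝ EB]
  {HB : Type*} [TopologicalSpace HB] {IB : ModelWithCorners ℝ EB HB} {n : ℕ∞ω}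
  {B : Type*} [TopologicalSpace B] [ChartedSpace HB B]
  {F : Type*} [NormedAddCommGroup F] [NormedSpace ℝ F]
  {E : B → Type*} [TopologicalSpace (TotalSpace F E)]
  [∀ b, TopologicalSpace (E b)] [∀ b, AddCommGroup (E b)] [∀ b, Module ℝ (E b)]
  [FiberBundle F E] [VectorBundle ℝ F E]

/-- **Constant rescaling of a metric.** For a real constant `c ≠ 0`, `g.constSmul c hc` is the
pseudo-Riemannian metric `c • g` (`(c • g)_b (v, w) = c * g_b (v, w)`): symmetric, nondegenerate
because `c ≠ 0`, and `C^n` by `ContMDiff.const_smul_section`. For `c > 0` this is a homothety of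
`g` (same signature); for `c < 0` the signature is reversed (`c = -1` is `g.neg`).
(Topping 2006, §1.2.3, "scaling distances by `λ^{1/2}`", i.e. `g ↦ λ g`; O'Neill 1983, Ch. 3,
Def. 3.1.) [cite: Topping2006, §1.2.3] -/
def _root_.Literature.Geometry.Lorentzian.PseudoRiemannianMetric.constSmul (g : PseudoRiemannianMetric IB n F E) (c : ℝ) (hc : c ≠ 0) :
    PseudoRiemannianMetric IB n F E where
  val b := c • g.val b
  symm b v w := by simp [g.symm b v w]
  nondegenerate b v hv := g.nondegenerate b v fun w ↦ by
    have h := hv w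
    simp only [FunLike.coe_smul, Pi.smul_apply, smul_eq_mul, mul_eq_zero] at h
    exact h.resolve_left hc
  contMDiff := g.contMDiff.const_smul_section (a := c)

/-- The value of `c • g`: `(c • g)_b = c • g_b`. [folklore] -/
@[simp]
lemma _root_.Literature.Geometry.Lorentzian.PseudoRiemannianMetric.val_constSmul (g : PseudoRiemannianMetric IB n F E) (c : ℝ) (hc : c ≠ 0) (b : B) :
    (g.constSmul c hc).val b = c • g.val b := rfl

/-- The value of `c • g` on vectors: `(c • g)_b (v, w) = c * g_b (v, w)`. [folklore] -/
lemma _root_.Literature.Geometry.Lorentzian.PseudoRiemannianMetric.constSmul_apply (g : PseudoRiemannianMetric IB n F E) (c : ℝ) (hc : c ≠ 0) (b : B)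
    (v w : E b) : (g.constSmul c hc).val b v w = c * g.val b v w := by
  simp

/-- Rescaling by `1` does nothing. [folklore] -/
@[simp]
lemma _root_.Literature.Geometry.Lorentzian.PseudoRiemannianMetric.constSmul_one (g : PseudoRiemannianMetric IB n F E) :
    g.constSmul 1 one_ne_zero = g := by
  ext b v w; simp

/-- Iterated rescaling: `d • (c • g) = (d * c) • g`. [folklore] -/
lemma _root_.Literature.Geometry.Lorentzian.PseudoRiemannianMetric.constSmul_constSmul (g : PseudoRiemannianMetric IB n F E) (c d : ℝ) (hc : c ≠ 0)
    (hd : d ≠ 0) :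
    (g.constSmul c hc).constSmul d hd = g.constSmul (d * c) (mul_ne_zero hd hc) := by
  ext b v w; simp [mul_assoc]

/-- Undoing a rescaling: `c⁻¹ • (c • g) = g`. [folklore] -/
@[simp]
lemma _root_.Literature.Geometry.Lorentzian.PseudoRiemannianMetric.constSmul_inv_constSmul (g : PseudoRiemannianMetric IB n F E) (c : ℝ) (hc : c ≠ 0) :
    (g.constSmul c hc).constSmul c⁻¹ (inv_ne_zero hc) = g := by
  rw [constSmul_constSmul]
  ext b v w; simp [inv_mul_cancel₀ hc]

/-- Rescaling by `-1` is negation `g.neg`. [folklore] -/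
lemma _root_.Literature.Geometry.Lorentzian.PseudoRiemannianMetric.constSmul_neg_one (g : PseudoRiemannianMetric IB n F E) :
    g.constSmul (-1) (by norm_num) = g.neg := by
  ext b v w; simp

/-- A positive multiple of a Riemannian metric is Riemannian. [folklore] -/
lemma _root_.Literature.Geometry.Lorentzian.PseudoRiemannianMetric.IsRiemannian.constSmul {g : PseudoRiemannianMetric IB n F E} (hg : g.IsRiemannian) {c : ℝ}
    (hc : 0 < c) : (g.constSmul c hc.ne').IsRiemannian :=
  fun b v hv ↦ by simpa using mul_pos hc (hg b v hv)

/-- For `c > 0`, `c • g` is Riemannian iff `g` is. [folklore] -/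
lemma _root_.Literature.Geometry.Lorentzian.PseudoRiemannianMetric.isRiemannian_constSmul_iff {g : PseudoRiemannianMetric IB n F E} {c : ℝ} (hc : 0 < c) :
    (g.constSmul c hc.ne').IsRiemannian ↔ g.IsRiemannian := by
  refine ⟨fun h b v hv ↦ ?_, fun h ↦ h.constSmul hc⟩
  have := h b v hv
  simp only [val_constSmul, FunLike.coe_smul, Pi.smul_apply, smul_eq_mul] at this
  exact (mul_pos_iff_of_pos_left hc).mp this

end Bundle

/-! ### Rescaling on the tangent bundle: compatibility, Levi-Civita, curvature, PIC -/

section Tangent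

variable {E : Type*} [NormedAddCommGroup E] [NormedSpace ℝ E] {H : Type*} [TopologicalSpace H]
  {I : ModelWithCorners ℝ E H} {M : Type*} [TopologicalSpace M] [ChartedSpace H M]
  [IsManifold I ∞ M] {n : ℕ∞ω}

omit [IsManifold I ∞ M] in
/-- The differential of a constant multiple of a real function along tangent vectors:
`d(c f) = c • df` (valid without differentiability hypotheses: if `f` is not differentiable at
`x`, neither is `c f` for `c ≠ 0`, and both differentials are the junk value `0`). [folklore] -/
theorem _root_.Literature.Geometry.Lorentzian.PseudoRiemannianMetric.mvfderiv_const_mul (f : M → ℝ) (c : ℝ) (x : M) :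
    mvfderiv I (fun y ↦ c * f y) x = c • mvfderiv I f x := by
  by_cases hf : MDiffAt f x
  · have hmul : (fun y ↦ c * f y) = (fun _ : M ↦ c) * f := rfl
    rw [hmul, mvfderiv_mul mdifferentiableAt_const hf, mvfderiv_const]
    simp
  · by_cases hc : c = 0
    · subst hc
      simp only [zero_mul, zero_smul]
      exact mvfderiv_const (I := I) (0 : ℝ)
    · have hf' : ¬ MDiffAt (fun y ↦ c * f y) x := by
        intro h
        apply hf
        have h2 := h.const_smul c⁻¹
        have hfun : (c⁻¹ • fun y ↦ c * f y) = f := by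
          funext y
          simp [← mul_assoc, inv_mul_cancel₀ hc]
        rwa [hfun] at h2
      simp [mvfderiv, mfderiv_zero_of_not_mdifferentiableAt hf,
        mfderiv_zero_of_not_mdifferentiableAt hf']

variable {g : PseudoRiemannianMetric I n E (TangentSpace I : M → Type _)}
  {cov : CovariantDerivative I E (TangentSpace I : M → Type _)}

/-- A connection compatible with `g` is compatible with every constant multiple `c • g`,
`c ≠ 0`: both sides of `X g(Y,Z) = g(∇_X Y, Z) + g(Y, ∇_X Z)` scale by `c`
(Topping 2006, §1.2.3: under `g ↦ λ g` "the connection also remains invariant").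
[cite: Topping2006, §1.2.3] -/
theorem _root_.Literature.Geometry.Lorentzian.PseudoRiemannianMetric.IsCompatible.constSmul (h : g.IsCompatible cov) (c : ℝ) (hc : c ≠ 0) :
    (g.constSmul c hc).IsCompatible cov := by
  intro x X Y Z hX hY hZ
  have hfun : (fun y ↦ (g.constSmul c hc).val y (Y y) (Z y)) = fun y ↦ c * g.val y (Y y) (Z y) :=
    funext fun y ↦ by simp
  rw [hfun, mvfderiv_const_mul, _root_.smul_apply, h hX hY hZ]
  simp [mul_add]

/-- Compatibility with `c • g` (`c ≠ 0`) is equivalent to compatibility with `g`. [folklore] -/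
theorem _root_.Literature.Geometry.Lorentzian.PseudoRiemannianMetric.isCompatible_constSmul_iff {c : ℝ} (hc : c ≠ 0) :
    (g.constSmul c hc).IsCompatible cov ↔ g.IsCompatible cov := by
  refine ⟨fun h ↦ ?_, fun h ↦ h.constSmul c hc⟩
  have h' := h.constSmul c⁻¹ (inv_ne_zero hc)
  rwa [constSmul_inv_constSmul] at h'

variable [FiniteDimensional ℝ E] [CompleteSpace E]

/-- **The Levi-Civita connection is invariant under constant rescaling of the metric**: a
Levi-Civita connection of `g` is a Levi-Civita connection of `c • g` for every `c ≠ 0`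
(torsion-freeness does not involve `g`; compatibility scales). Topping 2006, §1.2.3 ("The
connection also remains invariant"); O'Neill 1983, Ch. 3 (Koszul formula is homogeneous in `g`).
[cite: Topping2006, §1.2.3] -/
theorem _root_.Literature.Geometry.Lorentzian.PseudoRiemannianMetric.IsLeviCivita.constSmul (h : g.IsLeviCivita cov) (c : ℝ) (hc : c ≠ 0) :
    (g.constSmul c hc).IsLeviCivita cov :=
  ⟨h.1, h.2.constSmul c hc⟩

/-- `cov` is Levi-Civita for `c • g` (`c ≠ 0`) iff it is Levi-Civita for `g`. [cite: Topping2006, §1.2.3] -/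
theorem _root_.Literature.Geometry.Lorentzian.PseudoRiemannianMetric.isLeviCivita_constSmul_iff {c : ℝ} (hc : c ≠ 0) :
    (g.constSmul c hc).IsLeviCivita cov ↔ g.IsLeviCivita cov :=
  and_congr Iff.rfl (isCompatible_constSmul_iff hc)

omit [FiniteDimensional ℝ E] [CompleteSpace E] in
/-- The covariant curvature tensor `Rm = g(R(·,·)·, ·)` of a fixed connection scales like the
metric: `Rm_{c g} = c Rm_g`. (Topping 2006, §1.2.3: `Ric(ĝ) = Ric(g)` while lowered tensors pick
up the factor.) [folklore] -/
theorem _root_.Literature.Geometry.Lorentzian.PseudoRiemannianMetric.curvatureForm_constSmul (c : ℝ) (hc : c ≠ 0) (x : M) (X Y Z W : TangentSpace I x) :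
    (g.constSmul c hc).curvatureForm cov x X Y Z W = c * g.curvatureForm cov x X Y Z W := by
  simp [curvatureForm]

omit [FiniteDimensional ℝ E] [CompleteSpace E] in
/-- The isotropic curvatures of a fixed frame scale like the metric: `c • g` has isotropic
curvature `c` times that of `g` (same connection). [folklore] -/
theorem _root_.Literature.Geometry.Lorentzian.PseudoRiemannianMetric.isotropicCurvature_constSmul (c : ℝ) (hc : c ≠ 0) (x : M)
    (e : Fin 4 → TangentSpace I x) :
    (g.constSmul c hc).isotropicCurvature cov x e = c * g.isotropicCurvature cov x e := by
  simp only [isotropicCurvature, curvatureForm_constSmul]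
  ring

omit [FiniteDimensional ℝ E] [CompleteSpace E] in
/-- `Rm` is homogeneous of degree `4` under rescaling of its four arguments. [folklore] -/
theorem _root_.Literature.Geometry.Lorentzian.PseudoRiemannianMetric.curvatureForm_smul_smul_smul_smul (a : ℝ) (x : M) (X Y Z W : TangentSpace I x) :
    g.curvatureForm cov x (a • X) (a • Y) (a • Z) (a • W) = a ^ 4 * g.curvatureForm cov x X Y Z W := by
  simp only [curvatureForm, map_smul, _root_.smul_apply, smul_eq_mul]
  ring

omit [FiniteDimensional ℝ E] [CompleteSpace E] in
/-- The isotropic curvature of the rescaled frame `a • e` is `a⁴` times that of `e`. [folklore] -/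
theorem _root_.Literature.Geometry.Lorentzian.PseudoRiemannianMetric.isotropicCurvature_smul (a : ℝ) (x : M) (e : Fin 4 → TangentSpace I x) :
    g.isotropicCurvature cov x (a • e) = a ^ 4 * g.isotropicCurvature cov x e := by
  simp only [isotropicCurvature, Pi.smul_apply, curvatureForm_smul_smul_smul_smul]
  ring

omit [FiniteDimensional ℝ E] [CompleteSpace E] in
/-- Orthonormal frames of `c • g` (`c > 0`) are exactly the frames `e` such that `√c • e` is
`g`-orthonormal. [folklore] -/
theorem _root_.Literature.Geometry.Lorentzian.PseudoRiemannianMetric.isOrthonormalFrame_constSmul_iff {c : ℝ} (hc : 0 < c) {ι : Type*} (x : M)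
    (e : ι → TangentSpace I x) :
    (g.constSmul c hc.ne').IsOrthonormalFrame x e ↔ g.IsOrthonormalFrame x (Real.sqrt c • e) := by
  have hcc : Real.sqrt c * Real.sqrt c = c := Real.mul_self_sqrt hc.le
  -- both sides read `c * g(eᵢ, eⱼ) = δᵢⱼ` once `√c * √c = c` is used
  simp only [IsOrthonormalFrame, val_constSmul, Pi.smul_apply, smul_eq_mul, map_smul,
    _root_.smul_apply, ← mul_assoc, hcc]

omit [FiniteDimensional ℝ E] [CompleteSpace E] in
/-- **Positive isotropic curvature is scale invariant** (fixed connection): if `(g, cov)` has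
PIC then so has `(c • g, cov)` for every `c > 0` — a `(c • g)`-orthonormal frame `e` gives the
`g`-orthonormal frame `√c • e`, and `iso_{c g}(e) = c · iso_g(e) = c · c⁻² · iso_g(√c • e) > 0`.
(Hamilton 1997, §1: PIC is a condition on the curvature operator invariant under homothety.)
[folklore] -/
theorem _root_.Literature.Geometry.Lorentzian.PseudoRiemannianMetric.HasPositiveIsotropicCurvatureWith.constSmul (h : g.HasPositiveIsotropicCurvatureWith cov)
    {c : ℝ} (hc : 0 < c) : (g.constSmul c hc.ne').HasPositiveIsotropicCurvatureWith cov := by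
  intro x e he
  rw [isOrthonormalFrame_constSmul_iff hc] at he
  have hpos := h x _ he
  rw [isotropicCurvature_smul] at hpos
  have h4 : (0 : ℝ) < Real.sqrt c ^ 4 := by positivity
  rw [isotropicCurvature_constSmul]
  exact mul_pos hc ((mul_pos_iff_of_pos_left h4).mp hpos)

/-- **Positive isotropic curvature is invariant under homothety**: `g` has PIC iff `c • g` has,
for every constant `c > 0` (the Levi-Civita connections agree, `isLeviCivita_constSmul_iff`, and
PIC for a fixed connection is scale invariant). Used for parabolic rescaling of PIC Ricci flows
(Hamilton 1997, §E; Chen–Zhu 2006, §§3–4). [folklore] -/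
theorem _root_.Literature.Geometry.Lorentzian.PseudoRiemannianMetric.HasPositiveIsotropicCurvature.constSmul (h : g.HasPositiveIsotropicCurvature) {c : ℝ}
    (hc : 0 < c) : (g.constSmul c hc.ne').HasPositiveIsotropicCurvature :=
  fun cov hcov ↦ (h cov ((isLeviCivita_constSmul_iff hc.ne').mp hcov)).constSmul hc

/-- `c • g` (`c > 0`) has positive isotropic curvature iff `g` has. [folklore] -/
theorem _root_.Literature.Geometry.Lorentzian.PseudoRiemannianMetric.hasPositiveIsotropicCurvature_constSmul_iff {c : ℝ} (hc : 0 < c) :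
    (g.constSmul c hc.ne').HasPositiveIsotropicCurvature ↔ g.HasPositiveIsotropicCurvature := by
  refine ⟨fun h ↦ ?_, fun h ↦ h.constSmul hc⟩
  have h' := h.constSmul (inv_pos.mpr hc)
  have heq : (g.constSmul c hc.ne').constSmul c⁻¹ (inv_pos.mpr hc).ne' = g :=
    constSmul_inv_constSmul g c hc.ne'
  rwa [heq] at h'

end Tangent

end PseudoRiemannianMetric

end Literature.Geometry.Riemannian

/-! ### Rescaling smooth families and Ricci flows -/

namespace Literature.Geometry.Riemannian

open Lorentzian Lorentzian.PseudoRiemannianMetric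

section TotalSpace

variable {EM : Type*} [NormedAddCommGroup EM] [NormedSpace ℝ EM] {HM : Type*} [TopologicalSpace HM]
  {IM : ModelWithCorners ℝ EM HM} {M : Type*} [TopologicalSpace M] [ChartedSpace HM M]
  {EN : Type*} [NormedAddCommGroup EN] [NormedSpace ℝ EN] {HN : Type*} [TopologicalSpace HN]
  {J : ModelWithCorners ℝ EN HN} {N : Type*} [TopologicalSpace N] [ChartedSpace HN N]
  {F : Type*} [NormedAddCommGroup F] [NormedSpace ℝ F]
  {V : M → Type*} [TopologicalSpace (TotalSpace F V)] [∀ b, TopologicalSpace (V b)]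
  [∀ b, AddCommGroup (V b)] [∀ b, Module ℝ (V b)] [FiberBundle F V] [VectorBundle ℝ F V]
  {k : ℕ∞ω}

/-- **Scalar multiples of smooth maps into a vector bundle.** If `p ↦ (b p, v p)` is a `C^k` map
(within `u` at `p₀`) from a manifold `N` into the total space of a real vector bundle `V → M`
and `f : N → ℝ` is `C^k` (within `u` at `p₀`), then so is `p ↦ (b p, f p • v p)`: in the
trivialization at `b p₀` the fibre coordinate is multiplied by `f p` (linearity of the
trivialization on fibres). The case `N = M`, `b = id` is Mathlib's `ContMDiffWithinAt.smul_section`.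
[folklore] -/
theorem contMDiffWithinAt_totalSpace_smul {b : N → M} {v : ∀ p, V (b p)} {f : N → ℝ} {u : Set N}
    {p₀ : N} (hf : ContMDiffWithinAt J 𝓘(ℝ, ℝ) k f u p₀)
    (hv : ContMDiffWithinAt J (IM.prod 𝓘(ℝ, F)) k (fun p ↦ TotalSpace.mk' F (b p) (v p)) u p₀) :
    ContMDiffWithinAt J (IM.prod 𝓘(ℝ, F)) k (fun p ↦ TotalSpace.mk' F (b p) (f p • v p)) u p₀ := by
  rw [contMDiffWithinAt_totalSpace] at hv ⊢
  obtain ⟨hb, hv⟩ := hv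
  refine ⟨hb, ?_⟩
  set e := trivializationAt F V (b p₀) with he
  have hmem : ∀ᶠ p in 𝓝[u] p₀, b p ∈ e.baseSet :=
    hb.continuousWithinAt.preimage_mem_nhdsWithin
      (e.open_baseSet.mem_nhds (mem_baseSet_trivializationAt F V (b p₀)))
  refine (hf.smul hv).congr_of_eventuallyEq (hmem.mono fun p hp ↦ ?_) ?_
  · exact (e.linear ℝ hp).map_smul (f p) (v p)
  · exact (e.linear ℝ (mem_baseSet_trivializationAt F V (b p₀))).map_smul (f p₀) (v p₀)

/-- Constant multiples of smooth maps into a vector bundle are smooth (the case of a constant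
factor in `contMDiffWithinAt_totalSpace_smul`). [folklore] -/
theorem contMDiffWithinAt_totalSpace_const_smul {b : N → M} {v : ∀ p, V (b p)} {u : Set N}
    {p₀ : N} (a : ℝ)
    (hv : ContMDiffWithinAt J (IM.prod 𝓘(ℝ, F)) k (fun p ↦ TotalSpace.mk' F (b p) (v p)) u p₀) :
    ContMDiffWithinAt J (IM.prod 𝓘(ℝ, F)) k (fun p ↦ TotalSpace.mk' F (b p) (a • v p)) u p₀ :=
  contMDiffWithinAt_totalSpace_smul contMDiffWithinAt_const hv

end TotalSpace

variable {E : Type*} [NormedAddCommGroup E] [NormedSpace ℝ E] {H : Type*} [TopologicalSpace H]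
  {I : ModelWithCorners ℝ E H} {M : Type*} [TopologicalSpace M] [ChartedSpace H M]
  [IsManifold I ∞ M] {n : ℕ∞ω}

section Families

variable {k : ℕ∞ω} {g : ℝ → PseudoRiemannianMetric I n E (TangentSpace I : M → Type _)}
  {S : Set ℝ}

/-- A constant multiple `t ↦ c • g t` (`c ≠ 0`) of a `C^k` family of metrics is a `C^k` family.
[folklore] -/
theorem IsContMDiffFamilyOn.constSmul (h : IsContMDiffFamilyOn k g S) (c : ℝ) (hc : c ≠ 0) :
    IsContMDiffFamilyOn k (fun t ↦ (g t).constSmul c hc) S := fun p hp ↦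
  contMDiffWithinAt_totalSpace_const_smul c (h p hp)

/-- A `C^k` family of metrics multiplied by a `C^k` real function of time, `t ↦ φ t • g t`, is a
`C^k` map on `M × S` (stated for the total-space valued map, the factor being allowed to
vanish). [folklore] -/
theorem IsContMDiffFamilyOn.smul (h : IsContMDiffFamilyOn k g S) {φ : ℝ → ℝ}
    (hφ : ContDiffOn ℝ k φ S) :
    ContMDiffOn (I.prod 𝓘(ℝ, ℝ)) (I.prod 𝓘(ℝ, E →L[ℝ] E →L[ℝ] ℝ)) k
      (fun p : M × ℝ ↦ TotalSpace.mk' (E →L[ℝ] E →L[ℝ] ℝ) (E := fun b : M ↦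
        TangentSpace I b →L[ℝ] TangentSpace I b →L[ℝ] ℝ) p.1 (φ p.2 • (g p.2).val p.1))
      (univ ×ˢ S) := by
  intro p hp
  have hφ' : ContMDiffWithinAt (I.prod 𝓘(ℝ, ℝ)) 𝓘(ℝ, ℝ) k (fun p : M × ℝ ↦ φ p.2) (univ ×ˢ S) p :=
    (hφ.contMDiffOn.comp contMDiffOn_snd (fun q hq ↦ hq.2)) p hp
  exact contMDiffWithinAt_totalSpace_smul hφ' (h p hp)

/-- Affine time reparametrization of a `C^k` family: `t ↦ g (a * t + c)` is `C^k` on the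
preimage time set (compose with the smooth map `(x, t) ↦ (x, a t + c)` of `M × ℝ`). [folklore] -/
theorem IsContMDiffFamilyOn.comp_affine (h : IsContMDiffFamilyOn k g S) (a c : ℝ) :
    IsContMDiffFamilyOn k (fun t ↦ g (a * t + c)) ((fun t ↦ a * t + c) ⁻¹' S) := by
  have hφ₀ : ContDiff ℝ k (fun t : ℝ ↦ a * t + c) := (contDiff_id.const_smul a).add contDiff_const
  have hφ : ContMDiff (I.prod 𝓘(ℝ, ℝ)) (I.prod 𝓘(ℝ, ℝ)) k
      (fun p : M × ℝ ↦ (p.1, a * p.2 + c)) :=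
    contMDiff_fst.prodMk (hφ₀.contMDiff.comp contMDiff_snd)
  refine (ContMDiffOn.comp h hφ.contMDiffOn ?_ :)
  rintro ⟨x, t⟩ ⟨-, ht⟩
  exact ⟨mem_univ _, ht⟩

/-- Linear time reparametrization `t ↦ g (a * t)` of a `C^k` family. [folklore] -/
theorem IsContMDiffFamilyOn.comp_const_mul (h : IsContMDiffFamilyOn k g S) (a : ℝ) :
    IsContMDiffFamilyOn k (fun t ↦ g (a * t)) ((fun t ↦ a * t) ⁻¹' S) := by
  simpa using h.comp_affine a 0

end Families

section Rescaling

variable [FiniteDimensional ℝ E] [CompleteSpace E]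
  {g : ℝ → PseudoRiemannianMetric I ∞ E (TangentSpace I : M → Type _)}
  {cov : ℝ → CovariantDerivative I E (TangentSpace I : M → Type _)} {S : Set ℝ}

/-- **Parabolic rescaling of Ricci flows** (Topping 2006, §1.2.3, (1.2.7): "if one defines
`ĝ(x, t) = λ g(x, t/λ)` … then `∂ĝ/∂t = -2 Ric(ĝ)`", with "`Ric(ĝ) = Ric(g)`" and "The connection
also remains invariant"; Hamilton 1995/1997 and Chen–Zhu 2006, §§3–4, use it to blow up
singularities). If `(g, cov)` is a Ricci flow on the time set `S`, then for every `λ > 0` the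
rescaled family `t ↦ λ • g (t/λ)` with the same connections `t ↦ cov (t/λ)` is a Ricci flow on
the rescaled time set `λ S = (λ⁻¹ ·)⁻¹' S`: the Levi-Civita connections of `λ g` and `g` agree
(`IsLeviCivita.constSmul`), so the Ricci tensor is unchanged, while
`∂/∂t (λ g(t/λ)) = λ λ⁻¹ (∂g/∂s)(t/λ) = -2 Ric`. [cite: Topping2006, §1.2.3, (1.2.7)] -/
theorem IsRicciFlow.parabolicRescale (h : IsRicciFlow g cov S) {c : ℝ} (hc : 0 < c) :
    IsRicciFlow (fun t ↦ (g (c⁻¹ * t)).constSmul c hc.ne') (fun t ↦ cov (c⁻¹ * t))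
      ((fun t ↦ c⁻¹ * t) ⁻¹' S) where
  smooth := (h.smooth.comp_const_mul c⁻¹).constSmul c hc.ne'
  isLeviCivita t ht := (h.isLeviCivita (c⁻¹ * t) ht).constSmul c hc.ne'
  hasDerivWithinAt t ht x X Y := by
    have hd := h.hasDerivWithinAt (c⁻¹ * t) ht x X Y
    have hlin : HasDerivWithinAt (fun s : ℝ ↦ c⁻¹ * s) c⁻¹ ((fun s ↦ c⁻¹ * s) ⁻¹' S) t := by
      simpa using (hasDerivWithinAt_id t ((fun s ↦ c⁻¹ * s) ⁻¹' S)).const_mul c⁻¹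
    have hcomp := (hd.comp t hlin fun s hs ↦ hs).const_mul c
    have hfun : (fun s : ℝ ↦ ((g (c⁻¹ * s)).constSmul c hc.ne').val x X Y) =
        fun s ↦ c * ((fun s' : ℝ ↦ (g s').val x X Y) ∘ fun s' ↦ c⁻¹ * s') s := by
      funext s
      simp
    have hval : c * (-2 * (cov (c⁻¹ * t)).ricci x X Y * c⁻¹) = -2 * (cov (c⁻¹ * t)).ricci x X Y := by
      field_simp
    rw [hfun]
    exact hcomp.congr_deriv hval

omit [FiniteDimensional ℝ E] [CompleteSpace E] in
/-- Parabolic rescaling preserves the Riemannian character of the flow. [folklore] -/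
theorem isRiemannian_parabolicRescale {c : ℝ} (hc : 0 < c)
    (hR : ∀ t ∈ S, (g t).IsRiemannian) :
    ∀ t ∈ (fun t ↦ c⁻¹ * t) ⁻¹' S, ((g (c⁻¹ * t)).constSmul c hc.ne').IsRiemannian :=
  fun _ ht ↦ (hR _ ht).constSmul hc

/-- Parabolic rescaling preserves positive isotropic curvature along the flow. [folklore] -/
theorem hasPositiveIsotropicCurvature_parabolicRescale {c : ℝ} (hc : 0 < c)
    (hP : ∀ t ∈ S, (g t).HasPositiveIsotropicCurvature) :
    ∀ t ∈ (fun t ↦ c⁻¹ * t) ⁻¹' S,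
      ((g (c⁻¹ * t)).constSmul c hc.ne').HasPositiveIsotropicCurvature :=
  fun _ ht ↦ (hP _ ht).constSmul hc

end Rescaling

/-! ### Homothetic solutions: Einstein metrics -/

section Einstein

variable [FiniteDimensional ℝ E] [CompleteSpace E]

/-- The scale factor `σ_λ(t) = 1 - 2 λ t` of the homothetic Ricci flow of an Einstein metric,
modified to the (irrelevant) value `1` where `1 - 2 λ t ≤ 0` so that it never vanishes.
[cite: Topping2006, §1.2.1] -/
def einsteinFactor (l t : ℝ) : ℝ := if 0 < 1 - 2 * l * t then 1 - 2 * l * t else 1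

/-- On the natural time set `{t | 0 < 1 - 2 λ t}` the factor is `1 - 2 λ t`. [folklore] -/
theorem einsteinFactor_of_pos {l t : ℝ} (h : 0 < 1 - 2 * l * t) : einsteinFactor l t = 1 - 2 * l * t :=
  if_pos h

/-- The modified factor never vanishes (it is positive). [folklore] -/
theorem einsteinFactor_pos (l t : ℝ) : 0 < einsteinFactor l t := by
  unfold einsteinFactor
  split_ifs with h
  · exact h
  · exact one_pos

/-- At `t = 0` the factor is `1`. [folklore] -/
@[simp] theorem einsteinFactor_zero (l : ℝ) : einsteinFactor l 0 = 1 := by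
  simp [einsteinFactor]

/-- **The homothetic family of an Einstein metric**: `t ↦ (1 - 2 λ t) g₀` (Topping 2006, §1.2.1:
"a solution `g(t)` of (1.1.1) with `g(0) = g₀` is given by `g(t) = (1 - 2λt) g₀`"), defined for
all `t` by means of the non-vanishing modification `einsteinFactor` of the factor (the value
for `1 - 2 λ t ≤ 0`, where the true solution has become singular or is not defined, is the junk
value `g₀`). [cite: Topping2006, §1.2.1] -/
def einsteinFamily (g₀ : PseudoRiemannianMetric I n E (TangentSpace I : M → Type _)) (l : ℝ) :
    ℝ → PseudoRiemannianMetric I n E (TangentSpace I : M → Type _) :=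
  fun t ↦ g₀.constSmul (einsteinFactor l t) (einsteinFactor_pos l t).ne'

omit [FiniteDimensional ℝ E] [CompleteSpace E] in
/-- The homothetic family starts at `g₀`. [folklore] -/
@[simp] theorem einsteinFamily_zero (g₀ : PseudoRiemannianMetric I n E (TangentSpace I : M → Type _))
    (l : ℝ) : einsteinFamily g₀ l 0 = g₀ := by
  ext x v w
  simp [einsteinFamily]

omit [FiniteDimensional ℝ E] [CompleteSpace E] in
/-- Values of the homothetic family on its natural time set: `g(t)(v, w) = (1 - 2λt) g₀(v, w)`.
[cite: Topping2006, §1.2.1] -/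
theorem einsteinFamily_apply (g₀ : PseudoRiemannianMetric I n E (TangentSpace I : M → Type _))
    {l t : ℝ} (ht : 0 < 1 - 2 * l * t) (x : M) (v w : TangentSpace I x) :
    (einsteinFamily g₀ l t).val x v w = (1 - 2 * l * t) * g₀.val x v w := by
  simp [einsteinFamily, einsteinFactor_of_pos ht]

/-- **Einstein metrics evolve homothetically** (Topping 2006, §1.2.1: if `Ric(g₀) = λ g₀` then
"a solution `g(t)` of (1.1.1) with `g(0) = g₀` is given by `g(t) = (1 - 2λt) g₀`"; "the Ricci
tensor is invariant under uniform scalings of the metric"; e.g. the round unit sphere,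
`Ric(g₀) = (n-1) g₀`, "collapses to a point at time `T = 1/(2(n-1))`", and Ricci-flat metrics are
static). Let `cov₀` be a Levi-Civita connection of the smooth metric `g₀` whose Ricci tensor is
`Ric = λ g₀`. Then on every time set `S` on which `1 - 2 λ t > 0`, the homothetic family
`t ↦ (1 - 2 λ t) g₀` (`einsteinFamily g₀ λ`) with the constant connection `cov₀` is a Ricci flow:
`cov₀` is Levi-Civita for every positive multiple of `g₀` (`IsLeviCivita.constSmul`) and
`∂/∂t ((1 - 2λt) g₀(X, Y)) = -2 λ g₀(X, Y) = -2 Ric(X, Y)`. [cite: Topping2006, §1.2.1] -/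
theorem isRicciFlow_einsteinFamily (g₀ : PseudoRiemannianMetric I ∞ E (TangentSpace I : M → Type _))
    (cov₀ : CovariantDerivative I E (TangentSpace I : M → Type _)) (hLC : g₀.IsLeviCivita cov₀)
    (l : ℝ) (hRic : ∀ (x : M) (X Y : TangentSpace I x), cov₀.ricci x X Y = l * g₀.val x X Y)
    (S : Set ℝ) (hS : ∀ t ∈ S, 0 < 1 - 2 * l * t) :
    IsRicciFlow (einsteinFamily g₀ l) (fun _ ↦ cov₀) S where
  smooth := by
    -- on `M × S` the family map is `(x, t) ↦ (1 - 2 l t) • g₀ x`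
    have h0 : IsContMDiffFamilyOn ∞ (fun _ : ℝ ↦ g₀) S := isContMDiffFamilyOn_const g₀ S
    have hφ : ContDiffOn ℝ ∞ (fun t : ℝ ↦ 1 - 2 * l * t) S :=
      (contDiff_const.sub (contDiff_const.mul contDiff_id)).contDiffOn
    refine (h0.smul hφ).congr ?_
    rintro ⟨x, t⟩ ⟨-, ht⟩
    simp only [einsteinFamily, val_constSmul, einsteinFactor_of_pos (hS t ht)]
  isLeviCivita t _ := hLC.constSmul _ _
  hasDerivWithinAt t ht x X Y := by
    have hev : (fun s : ℝ ↦ (einsteinFamily g₀ l s).val x X Y) =ᶠ[𝓝[S] t]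
        fun s ↦ (1 - 2 * l * s) * g₀.val x X Y := by
      have hopen : IsOpen {s : ℝ | 0 < 1 - 2 * l * s} :=
        isOpen_lt continuous_const (continuous_const.sub (continuous_const.mul continuous_id))
      filter_upwards [mem_nhdsWithin_of_mem_nhds (hopen.mem_nhds (hS t ht))] with s hs
      exact einsteinFamily_apply g₀ hs x X Y
    have hd : HasDerivWithinAt (fun s : ℝ ↦ (1 - 2 * l * s) * g₀.val x X Y)
        (-2 * (cov₀.ricci x X Y)) S t := by
      have h1 : HasDerivWithinAt (fun s : ℝ ↦ 1 - 2 * l * s) (-(2 * l)) S t := by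
        simpa using ((hasDerivWithinAt_id t S).const_mul (2 * l)).const_sub 1
      have h2 := h1.mul_const (g₀.val x X Y)
      rw [hRic]
      exact h2.congr_deriv (by ring)
    exact hd.congr_of_eventuallyEq hev (einsteinFamily_apply g₀ (hS t ht) x X Y)

/-- The special case `λ = 0`: a Ricci-flat metric is a static Ricci flow on every time set
(compare `isRicciFlow_const_of_ricci_eq_zero`, the same statement for the literally constant
family). [cite: Topping2006, §1.2.1] -/
theorem isRicciFlow_einsteinFamily_zero (g₀ : PseudoRiemannianMetric I ∞ E (TangentSpace I : M → Type _))
    (cov₀ : CovariantDerivative I E (TangentSpace I : M → Type _)) (hLC : g₀.IsLeviCivita cov₀)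
    (hRic : ∀ x : M, cov₀.ricci x = 0) (S : Set ℝ) :
    IsRicciFlow (einsteinFamily g₀ 0) (fun _ ↦ cov₀) S :=
  isRicciFlow_einsteinFamily g₀ cov₀ hLC 0 (fun x X Y ↦ by simp [hRic x]) S
    (fun t _ ↦ by norm_num)

/-- **Finite extinction of shrinking homothetic solutions**: for `λ > 0` the natural time set of
the homothetic solution is `t < 1/(2λ)` — `1 - 2 λ t > 0 ↔ t < 1/(2λ)` — the "collapse to a
point at time `T = 1/(2λ)`" of Topping 2006, §1.2.1 (round unit `n`-sphere: `λ = n - 1`).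
[cite: Topping2006, §1.2.1] -/
theorem einsteinFactor_pos_iff {l : ℝ} (hl : 0 < l) (t : ℝ) :
    0 < 1 - 2 * l * t ↔ t < 1 / (2 * l) := by
  rw [lt_div_iff₀ (by positivity), sub_pos]
  constructor <;> intro h <;> nlinarith

/-- The shrinking homothetic solution of an Einstein metric with `Ric = λ g₀`, `λ > 0`, is a Ricci
flow on `[0, 1/(2λ))` starting at `g₀`. [cite: Topping2006, §1.2.1] -/
theorem isRicciFlow_einsteinFamily_Ico (g₀ : PseudoRiemannianMetric I ∞ E (TangentSpace I : M → Type _))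
    (cov₀ : CovariantDerivative I E (TangentSpace I : M → Type _)) (hLC : g₀.IsLeviCivita cov₀)
    {l : ℝ} (hl : 0 < l) (hRic : ∀ (x : M) (X Y : TangentSpace I x), cov₀.ricci x X Y = l * g₀.val x X Y) :
    IsRicciFlow (einsteinFamily g₀ l) (fun _ ↦ cov₀) (Ico 0 (1 / (2 * l))) ∧
      einsteinFamily g₀ l 0 = g₀ :=
  ⟨isRicciFlow_einsteinFamily g₀ cov₀ hLC l hRic _ fun t ht ↦ (einsteinFactor_pos_iff hl t).2 ht.2,
    einsteinFamily_zero g₀ l⟩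

end Einstein

end Literature.Geometry.Riemannian

end
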